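import Summits.MatrixMultiplication.MatrixMultiplication.Theorems.FidelityWitnessesLinearDefectLawTraceFrames
import Summits.MatrixMultiplication.MatrixMultiplication.Theorems.FidelityWitnessesSevenEighthsLawStubSliceElimination

/-!
# `FidelityWitnesses.LinearDefectLaw` (stmt-MatrixMultiplication-14039) — the `2 × 2` cyclic trace inequality, II:
# `‖AᵀB‖² + ‖BC‖² + ‖CAᵀ‖² ≤ 2 + |tr(AᵀBC)|²`

Support file for item `stmt-MatrixMultiplication-14039` (`LinearDefectLaw`) of route `MatrixMultiplication/FidelityWitnesses`:
the analytic core of the law's rank-3 rung at `n = 2` (`M(2,3) ≤ 4`).  After deflating `T = ⟨2,2,2⟩` in all three slots by unit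
functionals `α, β, γ` (`…LinearDefectLawSlotDeflation`), `‖(P_{α⊥}⊗P_{β⊥}⊗P_{γ⊥})T‖² = 2 + f` with
`f = ‖AᵀB‖² + ‖BC‖² + ‖CAᵀ‖² − |tr(AᵀBC)|²` for the unit `2 × 2` matrices `A = conj α`, `B = conj β`, `C = conj γ`; this file
proves `f ≤ 2` (`trace_ineq`, registered stub `stub_traceIneq`), for ALL unit-Frobenius `A, B, C : ℂ^{2×2}` (entrywise statement,
matrices as `Fin 2 → Fin 2 → ℂ`).  Equality holds on aligned rank-one chains (`E₁₁, E₁₁, E₁₁` or `E₁₁, E₁₂, E₂₁`).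

PROOF.  In a singular frame of `B` — orthonormal pairs `u` (left), `v` (right) of `ℂ²` with `u_iᴴ B v_j = 0` for `i ≠ j`
(`TraceIneq.exists_singular_frame` of part I `…TraceFrames`) — write
`b_j = u_jᴴBv_j`, `c_j = ‖Au_j‖²`, `ρ_j = ‖v_jᴴC‖²`, `M_{ij} = v_iᴴ C Aᵀ u_j`.  Parseval in these frames gives
`‖AᵀB‖² = Σ|b_j|²c_j`, `‖BC‖² = Σ|b_j|²ρ_j`, `‖CAᵀ‖² = Σ|M_{ij}|²`, `tr = Σ b_jM_{jj}`, `Σc_j = Σρ_j = Σ|b_j|² = 1`, and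
Cauchy–Schwarz `|M_{ij}|² ≤ ρ_ic_j`; the unitary identity `|b₀M₀₀+b₁M₁₁|² + |b̄₁M₀₀ − b̄₀M₁₁|² = (Σ|b_j|²)(|M₀₀|²+|M₁₁|²)`
reduces `2 − f ≥ 0` to `2|b₁|²ρ₀c₀ + 2|b₀|²ρ₁c₁ ≥ (|b₁||M₀₀| + |b₀||M₁₁|)²`, i.e. to `(|b₁||M₀₀| − |b₀||M₁₁|)² ≥ 0` plus the
Cauchy–Schwarz slacks (`scalar_core`, `nlinarith`).  No definitions.  Part I supplies the frames and Parseval; Cauchy–Schwarz is the tree's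
`SevenEighthsLaw.norm_sum_mul_sq_le`.
-/

noncomputable section

namespace Summit.MatrixMultiplication.MatrixMultiplication.Theorems.LinearDefectLaw.TraceIneq

open scoped BigOperators ComplexConjugate

set_option linter.dupNamespace false

/-! ## Expansions in a frame and the endgame -/

/-- expansion of a vector of `ℂ²` in an orthonormal pair: `w = Σ_i ⟨u_i, w⟩ u_i` -/
theorem expand_of_isONB {u : Fin 2 → Fin 2 → ℂ} (hu : ∀ i j, ∑ k, conj (u i k) * u j k = if i = j then (1 : ℂ) else 0) (w : Fin 2 → ℂ) (κ : Fin 2) :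
    w κ = ∑ i, (∑ κ', conj (u i κ') * w κ') * u i κ := by
  have h : ∑ i, (∑ κ', conj (u i κ') * w κ') * u i κ = ∑ κ', w κ' * ∑ i, u i κ * conj (u i κ') := by
    simp_rw [Finset.sum_mul, Finset.mul_sum]
    rw [Finset.sum_comm]
    exact Finset.sum_congr rfl fun κ' _ => Finset.sum_congr rfl fun i _ => by ring
  rw [h, Finset.sum_eq_single κ]
  · rw [complete_of_isONB hu κ κ, if_pos rfl, mul_one]
  · intro κ' _ hne
    rw [complete_of_isONB hu κ κ', if_neg (Ne.symm hne), mul_zero]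
  · intro hh; exact absurd (Finset.mem_univ κ) hh

/-- expansion in the conjugate pair: `w = Σ_j (Σ_{μ'} w μ' v_j μ') conj(v_j)` -/
theorem expand_conj_of_isONB {v : Fin 2 → Fin 2 → ℂ} (hv : ∀ i j, ∑ k, conj (v i k) * v j k = if i = j then (1 : ℂ) else 0) (w : Fin 2 → ℂ) (μ : Fin 2) :
    w μ = ∑ j, (∑ μ', w μ' * v j μ') * conj (v j μ) := by
  have h : ∑ j, (∑ μ', w μ' * v j μ') * conj (v j μ) = ∑ μ', w μ' * ∑ j, v j μ' * conj (v j μ) := by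
    simp_rw [Finset.sum_mul, Finset.mul_sum]
    rw [Finset.sum_comm]
    exact Finset.sum_congr rfl fun μ' _ => Finset.sum_congr rfl fun j _ => by ring
  rw [h, Finset.sum_eq_single μ]
  · rw [complete_of_isONB hv μ μ, if_pos rfl, mul_one]
  · intro μ' _ hne
    rw [complete_of_isONB hv μ' μ, if_neg hne, mul_zero]
  · intro hh; exact absurd (Finset.mem_univ μ) hh

/-- `‖Σ_j w_j conj(v_j)‖² = Σ_j |w_j|²` for an orthonormal pair `v` -/
theorem sum_norm_sq_combo_conj {v : Fin 2 → Fin 2 → ℂ} (hv : ∀ i j, ∑ k, conj (v i k) * v j k = if i = j then (1 : ℂ) else 0) (w : Fin 2 → ℂ) :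
    ∑ μ, ‖∑ j, w j * conj (v j μ)‖ ^ 2 = ∑ j, ‖w j‖ ^ 2 := by
  have key : ∀ μ, ((‖∑ j, w j * conj (v j μ)‖ ^ 2 : ℝ) : ℂ) =
      ∑ j, ∑ j', (conj (w j) * w j') * (conj (v j' μ) * v j μ) := by
    intro μ
    rw [Complex.ofReal_pow, ← Complex.conj_mul', map_sum, Finset.sum_mul]
    refine Finset.sum_congr rfl fun j _ => ?_
    rw [Finset.mul_sum]
    refine Finset.sum_congr rfl fun j' _ => ?_
    simp only [map_mul, Complex.conj_conj]
    ring
  apply Complex.ofReal_injective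
  rw [Complex.ofReal_sum, Complex.ofReal_sum]
  simp_rw [key]
  rw [Finset.sum_comm]
  refine Finset.sum_congr rfl fun j _ => ?_
  rw [Finset.sum_comm, Finset.sum_eq_single j]
  · rw [← Finset.mul_sum, hv j j, if_pos rfl, mul_one, Complex.conj_mul', Complex.ofReal_pow]
  · intro j' _ hne
    rw [← Finset.mul_sum, hv j' j, if_neg hne, mul_zero]
  · intro h; exact absurd (Finset.mem_univ j) h

/-- `‖Σ_j w_j u_j‖² = Σ_j |w_j|²` for an orthonormal pair `u` -/
theorem sum_norm_sq_combo {u : Fin 2 → Fin 2 → ℂ} (hu : ∀ i j, ∑ k, conj (u i k) * u j k = if i = j then (1 : ℂ) else 0) (w : Fin 2 → ℂ) :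
    ∑ κ, ‖∑ j, w j * u j κ‖ ^ 2 = ∑ j, ‖w j‖ ^ 2 := by
  have key : ∀ κ, ((‖∑ j, w j * u j κ‖ ^ 2 : ℝ) : ℂ) =
      ∑ j, ∑ j', (conj (w j) * w j') * (conj (u j κ) * u j' κ) := by
    intro κ
    rw [Complex.ofReal_pow, ← Complex.conj_mul', map_sum, Finset.sum_mul]
    refine Finset.sum_congr rfl fun j _ => ?_
    rw [Finset.mul_sum]
    refine Finset.sum_congr rfl fun j' _ => ?_
    simp only [map_mul]
    ring
  apply Complex.ofReal_injective
  rw [Complex.ofReal_sum, Complex.ofReal_sum]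
  simp_rw [key]
  rw [Finset.sum_comm]
  refine Finset.sum_congr rfl fun j _ => ?_
  rw [Finset.sum_comm, Finset.sum_eq_single j]
  · rw [← Finset.mul_sum, hu j j, if_pos rfl, mul_one, Complex.conj_mul', Complex.ofReal_pow]
  · intro j' _ hne
    rw [← Finset.mul_sum, hu j j', if_neg (Ne.symm hne), mul_zero]
  · intro h; exact absurd (Finset.mem_univ j) h

/-- a unit vector of an orthonormal pair has `Σ ‖u j κ‖² = 1` -/
theorem sum_norm_sq_of_isONB {u : Fin 2 → Fin 2 → ℂ} (hu : ∀ i j, ∑ k, conj (u i k) * u j k = if i = j then (1 : ℂ) else 0) (j : Fin 2) : ∑ κ, ‖u j κ‖ ^ 2 = 1 := by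
  have h := hu j j
  rw [if_pos rfl] at h
  simp_rw [Complex.conj_mul', ← Complex.ofReal_pow] at h
  rw [← Complex.ofReal_sum] at h
  exact_mod_cast h

/-- the unitary `2 × 2` identity `|p r + q s|² + |conj(q) r − conj(p) s|² = (|p|²+|q|²)(|r|²+|s|²)` -/
theorem norm_sq_rot_identity (p q r s : ℂ) :
    ‖p * r + q * s‖ ^ 2 + ‖conj q * r - conj p * s‖ ^ 2 = (‖p‖ ^ 2 + ‖q‖ ^ 2) * (‖r‖ ^ 2 + ‖s‖ ^ 2) := by
  simp only [Complex.sq_norm, Complex.normSq_apply, Complex.add_re, Complex.add_im, Complex.mul_re,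
    Complex.mul_im, Complex.sub_re, Complex.sub_im, Complex.conj_re, Complex.conj_im]
  ring

/-- the scalar endgame of the trace inequality (singular frame coordinates) -/
theorem scalar_core (B0 B1 c0 c1 r0 r1 m00 m01 m10 m11 k : ℝ) (hk0 : 0 ≤ k)
    (hB : B0 ^ 2 + B1 ^ 2 = 1) (hc : c0 + c1 = 1) (hr : r0 + r1 = 1)
    (h00 : m00 ^ 2 ≤ r0 * c0) (h01 : m01 ^ 2 ≤ r0 * c1) (h10 : m10 ^ 2 ≤ r1 * c0) (h11 : m11 ^ 2 ≤ r1 * c1)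
    (hk : k ≤ B1 * m00 + B0 * m11) :
    B0 ^ 2 * c0 + B1 ^ 2 * c1 + (B0 ^ 2 * r0 + B1 ^ 2 * r1) + (m00 ^ 2 + m01 ^ 2 + m10 ^ 2 + m11 ^ 2)
      ≤ 2 + (m00 ^ 2 + m11 ^ 2 - k ^ 2) := by
  have hk2 : k ^ 2 ≤ (B1 * m00 + B0 * m11) ^ 2 := pow_le_pow_left₀ hk0 hk 2
  have hP : 2 - (B0 ^ 2 * c0 + B1 ^ 2 * c1) - (B0 ^ 2 * r0 + B1 ^ 2 * r1) - r0 * c1 - r1 * c0 =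
      2 * B1 ^ 2 * (r0 * c0) + 2 * B0 ^ 2 * (r1 * c1) := by
    have ec1 : c1 = 1 - c0 := by linarith
    have er1 : r1 = 1 - r0 := by linarith
    have eB1 : B1 ^ 2 = 1 - B0 ^ 2 := by linarith
    rw [ec1, er1, eB1]; ring
  nlinarith [sq_nonneg (B1 * m00 - B0 * m11), mul_nonneg (sq_nonneg B1) (sub_nonneg.2 h00),
    mul_nonneg (sq_nonneg B0) (sub_nonneg.2 h11), hk2, hP, h01, h10]

/-- **The cyclic trace inequality for `2 × 2` matrices.** For unit-Frobenius `A, B, C : ℂ^{2×2}`,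
`‖AᵀB‖²_F + ‖BC‖²_F + ‖CAᵀ‖²_F ≤ 2 + |tr(AᵀBC)|²` (entrywise: `(AᵀB)_{νμ} = Σ_κ A κ ν B κ μ`, `(BC)_{κν} = Σ_μ B κ μ C μ ν`,
`(CAᵀ)_{μκ} = Σ_ν A κ ν C μ ν`, `tr(AᵀBC) = Σ A κ ν B κ μ C μ ν`).  Equality e.g. at aligned rank-one chains.  Proof: in a
singular frame of `B` everything is expressed by `|b_j|`, the masses `c_j = ‖Au_j‖²`, `ρ_j = ‖v_jᴴC‖²` and the mixed entries
`M_{ij}` of `CAᵀ`, with `|M_{ij}|² ≤ ρ_i c_j` (Cauchy–Schwarz); then `scalar_core`. [folklore] -/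
theorem trace_ineq (A B C : Fin 2 → Fin 2 → ℂ)
    (hA : ∑ κ, ∑ ν, ‖A κ ν‖ ^ 2 = 1) (hB : ∑ κ, ∑ μ, ‖B κ μ‖ ^ 2 = 1) (hC : ∑ μ, ∑ ν, ‖C μ ν‖ ^ 2 = 1) :
    (∑ ν, ∑ μ, ‖∑ κ, A κ ν * B κ μ‖ ^ 2) + (∑ κ, ∑ ν, ‖∑ μ, B κ μ * C μ ν‖ ^ 2)
      + (∑ κ, ∑ μ, ‖∑ ν, A κ ν * C μ ν‖ ^ 2) ≤ 2 + ‖∑ κ, ∑ μ, ∑ ν, A κ ν * B κ μ * C μ ν‖ ^ 2 := by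
  obtain ⟨u, v, hu, hv, h10, h01⟩ := exists_singular_frame B
  -- frame data
  set X : Fin 2 → Fin 2 → ℂ := fun ν j => ∑ κ, A κ ν * u j κ with hX
  set R : Fin 2 → Fin 2 → ℂ := fun j ν => ∑ μ, conj (v j μ) * C μ ν with hR
  set b : Fin 2 → ℂ := fun j => ∑ κ, conj (u j κ) * ∑ μ, B κ μ * v j μ with hb
  set M : Fin 2 → Fin 2 → ℂ := fun i j => ∑ ν, R i ν * X ν j with hM
  -- `B v_j = b_j u_j`
  have hBv : ∀ j κ, ∑ μ, B κ μ * v j μ = b j * u j κ := by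
    intro j κ
    rw [expand_of_isONB hu (fun κ' => ∑ μ, B κ' μ * v j μ) κ, Fin.sum_univ_two]
    fin_cases j
    · simp only [Fin.zero_eta, Fin.isValue, h10, zero_mul, add_zero]; rfl
    · simp only [Fin.mk_one, Fin.isValue, h01, zero_mul, zero_add]; rfl
  -- `B = Σ_j b_j u_j v_jᴴ`
  have hBexp : ∀ κ μ, B κ μ = ∑ j, b j * u j κ * conj (v j μ) := by
    intro κ μ
    rw [expand_conj_of_isONB hv (B κ) μ]
    exact Finset.sum_congr rfl fun j _ => by rw [hBv j κ]
  -- (E1) `‖AᵀB‖² = Σ_j |b_j|² c_j`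
  have hE1 : ∑ ν, ∑ μ, ‖∑ κ, A κ ν * B κ μ‖ ^ 2 = ∑ j, ‖b j‖ ^ 2 * ∑ ν, ‖X ν j‖ ^ 2 := by
    have h1 : ∀ ν μ, ∑ κ, A κ ν * B κ μ = ∑ j, (b j * X ν j) * conj (v j μ) := by
      intro ν μ
      simp_rw [hBexp, Finset.mul_sum]
      rw [Finset.sum_comm]
      refine Finset.sum_congr rfl fun j _ => ?_
      simp_rw [hX, Finset.mul_sum, Finset.sum_mul]
      exact Finset.sum_congr rfl fun κ _ => by ring
    simp_rw [h1, sum_norm_sq_combo_conj hv, norm_mul, mul_pow]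
    rw [Finset.sum_comm]
    simp_rw [Finset.mul_sum]
  -- (E2) `‖BC‖² = Σ_j |b_j|² ρ_j`
  have hE2 : ∑ κ, ∑ ν, ‖∑ μ, B κ μ * C μ ν‖ ^ 2 = ∑ j, ‖b j‖ ^ 2 * ∑ ν, ‖R j ν‖ ^ 2 := by
    have h1 : ∀ κ ν, ∑ μ, B κ μ * C μ ν = ∑ j, (b j * R j ν) * u j κ := by
      intro κ ν
      simp_rw [hBexp, Finset.sum_mul]
      rw [Finset.sum_comm]
      refine Finset.sum_congr rfl fun j _ => ?_
      simp_rw [hR, Finset.mul_sum, Finset.sum_mul]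
      exact Finset.sum_congr rfl fun μ _ => by ring
    simp_rw [h1]
    rw [Finset.sum_comm]
    simp_rw [sum_norm_sq_combo hu, norm_mul, mul_pow]
    rw [Finset.sum_comm]
    simp_rw [Finset.mul_sum]
  -- (E3) `tr = Σ_j b_j M_jj`
  have hE3 : ∑ κ, ∑ μ, ∑ ν, A κ ν * B κ μ * C μ ν = ∑ j, b j * M j j := by
    have h1 : ∀ κ ν, ∑ μ, B κ μ * C μ ν = ∑ j, (b j * R j ν) * u j κ := by
      intro κ ν
      simp_rw [hBexp, Finset.sum_mul]
      rw [Finset.sum_comm]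
      refine Finset.sum_congr rfl fun j _ => ?_
      simp_rw [hR, Finset.mul_sum, Finset.sum_mul]
      exact Finset.sum_congr rfl fun μ _ => by ring
    have h2 : ∀ κ, ∑ μ, ∑ ν, A κ ν * B κ μ * C μ ν = ∑ ν, A κ ν * ∑ μ, B κ μ * C μ ν := by
      intro κ
      rw [Finset.sum_comm]
      refine Finset.sum_congr rfl fun ν _ => ?_
      rw [Finset.mul_sum]
      exact Finset.sum_congr rfl fun μ _ => by ring
    simp_rw [h2, h1]
    -- `Σ_κ Σ_ν A κ ν Σ_j b_j R_jν u_jκ = Σ_j b_j Σ_ν R_jν X_νj`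
    have h3 : ∀ κ, ∑ ν, A κ ν * ∑ j, b j * R j ν * u j κ = ∑ j, ∑ ν, b j * R j ν * (A κ ν * u j κ) := by
      intro κ
      simp_rw [Finset.mul_sum]
      rw [Finset.sum_comm]
      exact Finset.sum_congr rfl fun j _ => Finset.sum_congr rfl fun ν _ => by ring
    simp_rw [h3]
    rw [Finset.sum_comm]
    refine Finset.sum_congr rfl fun j _ => ?_
    simp_rw [hM, hX, Finset.mul_sum]
    rw [Finset.sum_comm]
    exact Finset.sum_congr rfl fun ν _ => Finset.sum_congr rfl fun κ _ => by ring
  -- (E4) `‖CAᵀ‖² = Σ_{ij} |M_ij|²`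
  have hE4 : ∑ κ, ∑ μ, ‖∑ ν, A κ ν * C μ ν‖ ^ 2 = ∑ i, ∑ j, ‖M i j‖ ^ 2 := by
    rw [Finset.sum_comm, parseval₂ hu hv (fun μ κ => ∑ ν, A κ ν * C μ ν)]
    refine Finset.sum_congr rfl fun i _ => Finset.sum_congr rfl fun j _ => ?_
    -- both sides as the canonical triple sum `Σ_μ Σ_κ Σ_ν conj(v i μ) A κ ν C μ ν u j κ`
    have lhs : ∑ μ, ∑ κ, conj (v i μ) * (∑ ν, A κ ν * C μ ν) * u j κ =
        ∑ μ, ∑ κ, ∑ ν, conj (v i μ) * A κ ν * C μ ν * u j κ := by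
      refine Finset.sum_congr rfl fun μ _ => Finset.sum_congr rfl fun κ _ => ?_
      rw [Finset.mul_sum, Finset.sum_mul]
      exact Finset.sum_congr rfl fun ν _ => by ring
    have rhs : M i j = ∑ μ, ∑ κ, ∑ ν, conj (v i μ) * A κ ν * C μ ν * u j κ := by
      have e1 : M i j = ∑ ν, ∑ μ, ∑ κ, conj (v i μ) * A κ ν * C μ ν * u j κ := by
        simp only [hM, hR, hX]
        refine Finset.sum_congr rfl fun ν _ => ?_
        rw [Finset.sum_mul]
        refine Finset.sum_congr rfl fun μ _ => ?_
        rw [Finset.mul_sum]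
        exact Finset.sum_congr rfl fun κ _ => by ring
      rw [e1, Finset.sum_comm]
      exact Finset.sum_congr rfl fun μ _ => Finset.sum_comm
    rw [rhs, ← lhs]
  -- (N1) `Σ_j c_j = 1`, (N2) `Σ_j ρ_j = 1`, (N3) `Σ_j |b_j|² = 1`
  have hN1 : ∑ j, ∑ ν, ‖X ν j‖ ^ 2 = 1 := by
    rw [Finset.sum_comm]
    have h1 : ∀ ν, ∑ j, ‖X ν j‖ ^ 2 = ∑ κ, ‖A κ ν‖ ^ 2 := by
      intro ν
      have := sum_norm_sq_combo hu (fun κ => A κ ν)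
      -- wrong shape; use `parseval` instead
      have h := parseval hu (fun κ => A κ ν)
      simp_rw [hX]
      simpa [mul_comm] using h
    simp_rw [h1]
    rw [Finset.sum_comm]; exact hA
  have hN2 : ∑ j, ∑ ν, ‖R j ν‖ ^ 2 = 1 := by
    rw [Finset.sum_comm]
    have h1 : ∀ ν, ∑ j, ‖R j ν‖ ^ 2 = ∑ μ, ‖C μ ν‖ ^ 2 := fun ν => parseval_conj hv (fun μ => C μ ν)
    simp_rw [h1]
    rw [Finset.sum_comm]; exact hC
  have hN3 : ∑ j, ‖b j‖ ^ 2 = 1 := by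
    have h1 : ∀ κ, ∑ μ, ‖B κ μ‖ ^ 2 = ∑ j, ‖b j‖ ^ 2 * ‖u j κ‖ ^ 2 := by
      intro κ
      have h := sum_norm_sq_combo_conj hv (fun j => b j * u j κ)
      simp_rw [← hBexp] at h
      -- careful: `hBexp κ μ` is `B κ μ = Σ_j b j * u j κ * conj (v j μ)`
      simp_rw [norm_mul, mul_pow] at h
      exact h
    rw [← hB]
    simp_rw [h1]
    rw [Finset.sum_comm]
    simp_rw [← Finset.mul_sum, sum_norm_sq_of_isONB hu, mul_one]
  -- Cauchy–Schwarz for the mixed entries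
  have hCS : ∀ i j, ‖M i j‖ ^ 2 ≤ (∑ ν, ‖R i ν‖ ^ 2) * ∑ ν, ‖X ν j‖ ^ 2 :=
    fun i j => SevenEighthsLaw.norm_sum_mul_sq_le Finset.univ (R i) (fun ν => X ν j)
  -- the trace: `|b₀M₀₀ + b₁M₁₁|² = (|b₀|²+|b₁|²)(|M₀₀|²+|M₁₁|²) − |K|²`
  set K : ℂ := conj (b 1) * M 0 0 - conj (b 0) * M 1 1 with hK
  have hrot := norm_sq_rot_identity (b 0) (b 1) (M 0 0) (M 1 1)
  have hKle : ‖K‖ ≤ ‖b 1‖ * ‖M 0 0‖ + ‖b 0‖ * ‖M 1 1‖ := by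
    calc ‖K‖ ≤ ‖conj (b 1) * M 0 0‖ + ‖conj (b 0) * M 1 1‖ := norm_sub_le _ _
      _ = ‖b 1‖ * ‖M 0 0‖ + ‖b 0‖ * ‖M 1 1‖ := by rw [norm_mul, norm_mul, Complex.norm_conj, Complex.norm_conj]
  -- assemble
  have c00 := hCS 0 0
  have c01 := hCS 0 1
  have c10 := hCS 1 0
  have c11 := hCS 1 1
  rw [hE1, hE2, hE3, hE4]
  simp only [Fin.sum_univ_two, Fin.isValue] at hN1 hN2 hN3 c00 c01 c10 c11 ⊢
  have hfin := scalar_core ‖b 0‖ ‖b 1‖ (‖X 0 0‖ ^ 2 + ‖X 1 0‖ ^ 2) (‖X 0 1‖ ^ 2 + ‖X 1 1‖ ^ 2)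
    (‖R 0 0‖ ^ 2 + ‖R 0 1‖ ^ 2) (‖R 1 0‖ ^ 2 + ‖R 1 1‖ ^ 2) ‖M 0 0‖ ‖M 0 1‖ ‖M 1 0‖ ‖M 1 1‖ ‖K‖
    (norm_nonneg _) hN3 hN1 hN2 c00 c01 c10 c11 hKle
  rw [hN3, one_mul] at hrot
  linarith [hfin, hrot]

/-- **Registered stub `stub_traceIneq`** (raw form of `trace_ineq`). -/
theorem stub_traceIneq : ∀ (A B C : Fin 2 → Fin 2 → ℂ), (∑ κ, ∑ ν, ‖A κ ν‖ ^ 2) = 1 → (∑ κ, ∑ μ, ‖B κ μ‖ ^ 2) = 1 → (∑ μ, ∑ ν, ‖C μ ν‖ ^ 2) = 1 → (∑ ν, ∑ μ, ‖∑ κ, A κ ν * B κ μ‖ ^ 2) + (∑ κ, ∑ ν, ‖∑ μ, B κ μ * C μ ν‖ ^ 2) + (∑ κ, ∑ μ, ‖∑ ν, A κ ν * C μ ν‖ ^ 2) ≤ 2 + ‖∑ κ, ∑ μ, ∑ ν, A κ ν * B κ μ * C μ ν‖ ^ 2 :=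
  fun A B C hA hB hC => trace_ineq A B C hA hB hC

end Summit.MatrixMultiplication.MatrixMultiplication.Theorems.LinearDefectLaw.TraceIneq

end
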